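import Literature.Probability.Percolation.FourArmGarbanCircuitBits
import Literature.Probability.Percolation.LatticeSymmetry
import HarnessLib

/-!
# Arms from a square to the four sides of a larger square (landing areas = sides), on `ℤ²`

Topic `Literature/Probability/Percolation`; definitions + elementary API, first brick (S1a) of the
arm-separation input of `Literature.Probability.Percolation.Garban2011_fourArm_multiscale`
(`FourArmGarban.lean`; C. Garban, Appendix B of O. Schramm, S. Smirnov, Ann. Probab. 39 (2011),
(B.2): "`Q_j` is pivotal for `X` if and only if there are two open arms connecting `∂Q_j` to
`∂₀Q` and `∂₂Q`, and two dual closed arms connecting `∂Q_j` to `∂₁Q` and `∂₃Q`"; P. Nolin,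
EJP 13 (2008), §4.2, Def. 8 and Remark 9: arm events with prescribed *landing areas*, "if we take
[...] as landing areas `Ī₁, …, Ī₄` the (resp.) right, top, left and bottom sides of `∂S_N`, the
4-arm event `Ā_{4,σ̄}^{./Ī}(0,N)` is then the event that `0` is pivotal for the existence of a
left-right crossing of `S_N`"). Bond percolation on `ℤ²`; no named fact.

* `sideOf k L` (`k : Fin 4`) — the right / top / left / bottom side of the sup-norm sphere
  `‖·‖_∞ = L` (`x₀ = L`, `x₁ = L`, `x₀ = -L`, `x₁ = -L`), a subset of `siteSphere L`;
* `openArmToSideAt c ρ L k` — **an open arm from the square `c + B(ρ)` to the `k`-th side of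
  `c + B(L)`**: an open path of the annulus `c + A_{ρ,L}` from a site of `c + {‖·‖_∞ = ρ}` to a
  site of `c + sideOf k L`; defined as an instance of the tree's `openCrossing S A B`
  (`Crossings.lean`), hence increasing (`isUpperSet_openArmToSideAt`) and measurable
  (`measurableSet_openArmToSideAt`); its probability does not depend on the centre
  (`real_openArmToSideAt`, translation invariance `real_openCrossing_shift`);
* `dualArmToSideAt c ρ L k := dualConfig ⁻¹' openArmToSideAt c ρ L k` — **a closed dual arm**
  (the same event for the dual configuration: a path of dual vertices, indexed by lower-left
  corners as everywhere in the tree, through dual edges crossing closed edges), decreasing and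
  measurable.

The alternating four-arm-to-sides event of Garban's (B.2) / Nolin's Remark 9 is the intersection
of two `openArmToSideAt` (sides `0`, `2`) and two `dualArmToSideAt` (sides `1`, `3`, for the
appropriate dual radii); its identification with block-pivotality of the square crossing and the
comparison with `fourArmTwoClustersAt` (separation) are the next bricks.

## References

* O. Schramm, S. Smirnov (appendix by C. Garban), Ann. Probab. 39 (2011), Appendix B, (B.2)
  [SchrammSmirnov2011].
* P. Nolin, *Near-critical percolation in two dimensions*, Electron. J. Probab. 13 (2008), §4.2,
  Def. 8, Remark 9 (arXiv 0711.4948 numbering) [Nolin2008].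

Tree: `openCrossing`, `isUpperSet_openCrossing` (`Crossings.lean`), `measurableSet_openCrossing`
(`PlanarDuality.lean`), `real_openCrossing_shift` (`LatticeSymmetry.lean`), `siteSphere`, `sqAnnulus`
(`FourArmGarban.lean`), `dualConfig`, `dualConfig_antitone`, `measurable_dualConfig`, `Site.shift`.
-/

noncomputable section

namespace Literature.Probability.Percolation

open _root_.MeasureTheory Set LatticeModels

/-! ### Sides of a sup-norm sphere -/

/-- The `k`-th **side of the sphere `‖·‖_∞ = L`**: `k = 0` right (`x₀ = L`), `k = 1` top
(`x₁ = L`), `k = 2` left (`x₀ = -L`), `k = 3` bottom (`x₁ = -L`) — Nolin's landing areas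
`Ī₁, …, Ī₄` of Remark 9, Garban's `∂₀Q, …, ∂₃Q`. [cite: Nolin2008, §4.2 Remark 9 (arXiv 0711.4948)] -/
def sideOf (k : Fin 4) (L : ℕ) : Finset (Site 2) := by
  classical
  exact (siteSphere L).filter fun x =>
    (k = 0 ∧ x 0 = L) ∨ (k = 1 ∧ x 1 = L) ∨ (k = 2 ∧ x 0 = -(L : ℤ)) ∨ (k = 3 ∧ x 1 = -(L : ℤ))

/-- Sides are parts of the sphere. [folklore] -/
theorem sideOf_subset (k : Fin 4) (L : ℕ) : sideOf k L ⊆ siteSphere L := by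
  classical
  intro x hx
  simp only [sideOf, Finset.mem_filter] at hx
  exact hx.1

/-! ### Open and dual arms to a side -/

/-- **An open arm from `c + B(ρ)` to the `k`-th side of `c + B(L)`**: an open path all of whose
sites lie in the annulus `c + A_{ρ,L}` (`= c + (annulus 2 (ρ-1) L)`), from a site of the sphere
`c + {‖·‖_∞ = ρ}` to a site of `c + sideOf k L` (Garban's "open arm connecting `∂Q_j` to `∂₀Q`";
Nolin's arm with landing area a side). [cite: SchrammSmirnov2011, Appendix B, (B.2) (arms from ∂Q_j to the sides of Q)] -/
def openArmToSideAt (c : Site 2) (ρ L : ℕ) (k : Fin 4) : Set (BondConfig (Site 2)) :=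
  openCrossing (↑((annulus 2 (ρ - 1) L).image (Site.shift c)) : Set (Site 2))
    (↑((siteSphere ρ).image (Site.shift c)) : Set (Site 2))
    (↑((sideOf k L).image (Site.shift c)) : Set (Site 2))

/-- **A closed dual arm from `c + B(ρ)` to the `k`-th side of `c + B(L)`**: the open arm event of
the dual configuration (dual vertices indexed by lower-left corners; dual edges open iff they cross
closed edges, `dualConfig`). [cite: SchrammSmirnov2011, Appendix B, (B.2) (dual closed arms from ∂Q_j to the sides of Q)] -/
def dualArmToSideAt (c : Site 2) (ρ L : ℕ) (k : Fin 4) : Set (BondConfig (Site 2)) :=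
  dualConfig ⁻¹' openArmToSideAt c ρ L k

/-- Membership in the open arm event, unfolded. [folklore] -/
theorem mem_openArmToSideAt_iff {c : Site 2} {ρ L : ℕ} {k : Fin 4} {ω : BondConfig (Site 2)} :
    ω ∈ openArmToSideAt c ρ L k ↔ ∃ x, x - c ∈ siteSphere ρ ∧ ∃ y, y - c ∈ sideOf k L ∧
      ω ∈ openConnIn (↑((annulus 2 (ρ - 1) L).image (Site.shift c)) : Set (Site 2)) x y := by
  simp only [openArmToSideAt, mem_openCrossing_iff, Finset.coe_image, Set.mem_image,
    Finset.mem_coe, Site.shift_apply]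
  constructor
  · rintro ⟨x, ⟨x₀, hx₀, rfl⟩, y, ⟨y₀, hy₀, rfl⟩, h⟩
    exact ⟨x₀ + c, by simpa using hx₀, y₀ + c, by simpa using hy₀, h⟩
  · rintro ⟨x, hx, y, hy, h⟩
    exact ⟨x, ⟨x - c, hx, sub_add_cancel x c⟩, y, ⟨y - c, hy, sub_add_cancel y c⟩, h⟩

/-- The open arm event is increasing. [folklore] -/
theorem isUpperSet_openArmToSideAt (c : Site 2) (ρ L : ℕ) (k : Fin 4) :
    IsUpperSet (openArmToSideAt c ρ L k) :=
  isUpperSet_openCrossing _ _ _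

/-- The open arm event is measurable (a local event of the finite annulus). [folklore] -/
theorem measurableSet_openArmToSideAt (c : Site 2) (ρ L : ℕ) (k : Fin 4) :
    MeasurableSet (openArmToSideAt c ρ L k) :=
  measurableSet_openCrossing _ _ _

/-- The dual arm event is decreasing. [folklore] -/
theorem isLowerSet_dualArmToSideAt (c : Site 2) (ρ L : ℕ) (k : Fin 4) :
    IsLowerSet (dualArmToSideAt c ρ L k) :=
  fun _ _ hle h => isUpperSet_openArmToSideAt c ρ L k (dualConfig_antitone hle) h

/-- The dual arm event is measurable. [folklore] -/
theorem measurableSet_dualArmToSideAt (c : Site 2) (ρ L : ℕ) (k : Fin 4) :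
    MeasurableSet (dualArmToSideAt c ρ L k) :=
  measurable_dualConfig (measurableSet_openArmToSideAt c ρ L k)

/-! ### Translation invariance -/

/-- The translated finite sets as images under `· + c`. [folklore] -/
theorem coe_image_shift (F : Finset (Site 2)) (c : Site 2) :
    (↑(F.image (Site.shift c)) : Set (Site 2)) = (· + c) '' (↑F : Set (Site 2)) := by
  rw [Finset.coe_image]
  rfl

/-- **Translation invariance**: the probability of an open arm from `c + B(ρ)` to the `k`-th side
of `c + B(L)` does not depend on `c`. [folklore] -/
theorem real_openArmToSideAt (p : unitInterval) (c : Site 2) (ρ L : ℕ) (k : Fin 4) :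
    (bondPercolation (zdGraph 2) p).real (openArmToSideAt c ρ L k) =
      (bondPercolation (zdGraph 2) p).real (openArmToSideAt 0 ρ L k) := by
  have h0 : ∀ F : Finset (Site 2), (↑(F.image (Site.shift (0 : Site 2))) : Set (Site 2)) = ↑F :=
    fun F => by
      rw [coe_image_shift]
      rw [show (fun x : Site 2 => x + 0) = id from funext fun x => add_zero x, Set.image_id]
  simp only [openArmToSideAt, coe_image_shift, h0]
  rw [← coe_image_shift, ← coe_image_shift, ← coe_image_shift, coe_image_shift, coe_image_shift,
    coe_image_shift]
  exact real_openCrossing_shift p c _ _ _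

end Literature.Probability.Percolation
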